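import Summits.QuantumFields.BalabanUV.T4Continuum.Support.NE3ResidualSliceRep
import Summits.QuantumFields.BalabanUV.T4Continuum.Support.NE3EnergyHessCont
import Summits.QuantumFields.BalabanUV.T4Continuum.Support.NE3CurlPairedResidualSpread
import HarnessLib

/-!
# T⁴ programme, node NE3 — route Π, file 2 of D-ne3p1-g25-1 §4: `DecomposedRep` FROM A RESIDUAL SLICE REPRESENTATIVE ADAPTED TO A LINEAR NORMAL
# PART — the three SIZES of the normal part `N = log(e^{X₀}e^{X})` are those of the LINEAR normal part `Nn` up to displayed k-free factors

NE3 (node U1b), row NE3 OWNER `b2b-balaban-t4-ne3-p1` (gen 25); design `D-ne3p1-g25-1.md` §§1–2, §4 (file 2) and ruling ρ-g25-2 (the R-ADAPTED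
form of Π-L1♮: the gauge leaf absorbs the slice normalisation, so that the kernel right inverse of route Π needs NO frame∕Ξ₀₀ normalisation).
Inputs BY NAME: file 1 `NE3ResidualSliceRep` (`ResidualSliceRep`, `normalPart`, `norm_normalPart_sub_le`, `norm_normalPart_le`, `normalPart_skew`,
`exp_normalPart_mul_exp_neg`, `sub_mem_frameFreeBlockLandauW`), `NE3ProductPathChart.DecomposedRep` (p237527), the weighted-norm kit
`NE3ProductPathBounds` (`energyNormW_le_of_pointwise`, `energyNormW_add_le`, `sum_norm_curl_le_dirL1`, `curl_add_dir`).

WHAT.  §1 the R-ADAPTED RESIDUAL SLICE REPRESENTATIVE `ResidualSliceRepT L N k W UA u X₀ Nn α₀`: a residual (corner-trivial) unitary periodic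
gauge `u`, `U_A^u = W·e^{X₀}`, `X₀` skew periodic with `sup ≤ α₀`, and THE SLICE CONDITION IN ADAPTED FORM: `Nn − X₀ ∈ T_♮(W)` for the given
linear normal part `Nn` (in route Π: `Nn := R_W(D_W X₀)`, leaf-01's smooth right inverse applied to the linearised average of `X₀`).  A hypothesis
SHAPE asserted for nothing (B11 Prop. 2 TYPE-analogue in the residual gauge group, adapted to the splitting `ker D_W ⊕ im R_W`; ours); file 1's
intrinsic form implies it (`residualSliceRepT_of_intrinsic`: frame-free + Ξ₀₀-orthogonal `X₀` AND `Nn` with `D_W Nn = D_W X₀`).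
§2 **`decomposedRep_of_linearNormalPart`**: at a pair `(U_A, U_B)` of level `j+1` with background `W = cavg L U_B` in the multi-level small-field
class and admissible for run A: `ResidualSliceRepT` (α₀ ≤ 1∕100) ∧ `Nn` periodic with sup `≤ αN ≤ 1∕2700` ∧ the (J1) line
`(α₀ + 43αN)·L^{j+1} ≤ 1` ∧ the three PRE-SIZES of `Nn` against the tangent datum `X := Nn − X₀` (`‖Nn‖_w ≤ ν₀‖X‖_w`,
`a·Σ_{perWin}‖curl_W Nn‖ ≤ k₁‖X‖_w²`, `a·((α₀+αN)·dirL1 Nn) ≤ k₂‖X‖_w²`) ∧ the plaquette radius `a` of the product path ⟹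
`DecomposedRep 𝒞 L N (j+1) V U_A U_B u X N α αN′ ν κ₁ κ₂ a` with `N := normalPart X₀ X`, `α := α₀ + αN`, `αN′ := (1 + 2048(α₀+αN))·αN`,
**`ν := (1 + 2048·√(16d+1))·ν₀`, `κ₁ := k₁ + 8192·d·k₂`, `κ₂ := 1806·k₂`** — displayed, k-FREE.  The only estimate used is file 1's bondwise
`‖N − Nn‖ ≤ 2048·‖X‖·‖Nn‖`; the (J1) line pays the `L^{j+1}` of the pointwise-to-weighted conversion.

HONEST FRAMING.  Bookkeeping; the pre-sizes of `Nn`, the plaquette radius and `ResidualSliceRepT` are HYPOTHESES (suppliers: route Π's Π-R letters,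
Π-C sup form × the local sup majorant (Π-REG), the plaquette file 3b); (P♮)_W's numeric lines, (H∃), T-E_w♯ and NE3 are NOT proved; spine PROVED
0∕9; finite T⁴ rung (B)+1 — NOT infinite volume, NOT mass gap, NOT `BetaPertH`, NOT Clay.  PLACEMENT: `Summits/QuantumFields/BalabanUV/`.
HONEST DEPENDENCY: continuum YM on T⁴ ⇐ BetaPertH ∧ nine spine estimates (0/9 proved); BetaPertH ⇐ (D1) ∧ (D4) ∧ CAP+tail; G-an2-4 gates asym,
D1 and NE2/3/4.
-/

set_option autoImplicit false

open scoped BigOperators Matrix.Norms.L2Operator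
open NormedSpace Finset

namespace Summit.QuantumFields.BalabanUV.T4Continuum.NE3DecomposedRepOfLinearNormalPart

open Set
open Literature.MathematicalPhysics.QuantumFieldTheory.Balaban1983to89
open B7Prop1Explicit B7Prop2Explicit MatrixLog
open T4AveragingDeficitWall (IsSkewDir IsUnitaryCfg SmallField vary curl curlSq dirSq dirL1 fhol)
open T4AveragingDeficitWallBoundary (IsPeriodicCfg periodBox)
open AveragingDeficitPeriodicCounting (IsPeriodicDir)
open AveragingDeficitChartCalculus (cavg)
open AveragingDeficitMultiLevelPrep (cavgIter TangentIter tower LevelSmall)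
open BlockAveragePushDirGauge (gaugeDir)
open MinimalActionLevels (perWin)
open MinimalActionSandwich (admissible)
open NE3EnergyShapes (IsUnitarySite IsPeriodicSite)
open NE3CovariantCalculus (hsR)
open NE3TangentCovariantTower (dirIter framePotW)
open NE3FrameFreeSliceW (frameFreeBlockLandauW cornerGaugeSpaceW)
open NE3EnergyRateWSupOfSlicePoincare (mem_frameFreeBlockLandauW_struct)
open NE3EnergyWeightedShapes (energyNormW energyNormW_nonneg)
open NE3HessShapes (plaqsOf)
open NE3ProductPath (pathΓ)
open NE3ProductPathBounds (energyNormW_le_of_pointwise energyNormW_add_le sum_norm_curl_le_dirL1 curl_add_dir)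
open NE3ProductPathChart (DecomposedRep)
open AveragingDeficitDerivCore (dirL1_nonneg)
open NE3EnergyHessCont (perWin_eq_plaqsOf)
open NE3CurlPairedResidualSpread (dirL1_le_of_pointwise)
open NE3ResidualSliceRep (ResidualSliceRep normalPart norm_normalPart_sub_le norm_normalPart_le normalPart_skew exp_normalPart_mul_exp_neg
  sub_mem_frameFreeBlockLandauW)

noncomputable section

variable {d : ℕ} {n : Type*} [Fintype n] [DecidableEq n]

/-! ## §1 The R-adapted residual slice representative -/

/-- **Π-L1♮ IN R-ADAPTED FORM — THE RESIDUAL SLICE REPRESENTATIVE ADAPTED TO A LINEAR NORMAL PART** at level `k`, background `W`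
(period `N·L^k`): a unitary periodic CORNER-TRIVIAL gauge `u` (`u(L^k·z) = 1`), the relative field `X₀` (`U_A^u = W·e^{X₀}`, skew, periodic,
sup `≤ α₀`), and the slice condition `Nn − X₀ ∈ T_♮(W)` for the given linear normal part `Nn`.  A hypothesis SHAPE asserted for nothing
(B11 Prop. 2 TYPE-analogue in the residual group, adapted to `ker D_W ⊕ im R_W`; ours). [folklore] -/
@[folklore]
structure ResidualSliceRepT (L N k : ℕ) (W UA : Site d → Fin d → (Matrix n n ℂ)ˣ) (u : Site d → (Matrix n n ℂ)ˣ)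
    (X₀ Nn : Site d → Fin d → Matrix n n ℂ) (α₀ : ℝ) : Prop where
  /-- the gauge transformation is `U(N)`-valued and periodic -/
  gauge : IsUnitarySite u ∧ IsPeriodicSite u ((N * L ^ k : ℕ) : ℤ)
  /-- RESIDUAL: the gauge transformation is trivial at the block corners of level `k` -/
  cornerTrivial : ∀ z : Site d, u (((L : ℤ) ^ k) • z) = 1
  /-- the representation `U_A^u = W·e^{X₀}` -/
  rep : gaugeAct u UA = vary W X₀ 1
  /-- the relative field is skew -/
  skew : IsSkewDir X₀
  /-- the relative field is periodic -/
  per : IsPeriodicDir X₀ ((N * L ^ k : ℕ) : ℤ)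
  /-- the sup datum is non-negative -/
  hα₀ : 0 ≤ α₀
  /-- sup bound of the relative field -/
  sup : ∀ (x : Site d) (μ : Fin d), ‖X₀ x μ‖ ≤ α₀
  /-- THE ADAPTED SLICE CONDITION: the tangent datum `Nn − X₀` lies in the curved frame-free slice `T_♮(W)` -/
  tangent : (fun y μ => Nn y μ - X₀ y μ) ∈ frameFreeBlockLandauW (d := d) (n := n) L N k W

/-- **THE INTRINSIC FORM IMPLIES THE ADAPTED FORM**: file 1's `ResidualSliceRep` (frame-free, Ξ₀₀-orthogonal `X₀`) together with a linear
normal part `Nn` that is skew, periodic, frame-free, Ξ₀₀-orthogonal and has the same linearised average gives `ResidualSliceRepT`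
(multi-level small-field class at `W`). [folklore] -/
theorem residualSliceRepT_of_intrinsic [Nonempty n] {L N : ℕ} (hL : 1 ≤ L) (j : ℕ) {W UA : Site d → Fin d → (Matrix n n ℂ)ˣ}
    {x : ℝ} (hWu : IsUnitaryCfg W) (hx : 0 ≤ x) (hs : LevelSmall d L j x) (hWx : SmallField W x)
    {u : Site d → (Matrix n n ℂ)ˣ} {X₀ : Site d → Fin d → Matrix n n ℂ} {α₀ : ℝ} (h : ResidualSliceRep L N (j + 1) W UA u X₀ α₀)
    {Nn : Site d → Fin d → Matrix n n ℂ} (hNs : IsSkewDir Nn) (hNP : IsPeriodicDir Nn ((N * L ^ (j + 1) : ℕ) : ℤ))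
    (hNF : ∀ z, framePotW L (j + 1) W Nn z = 0)
    (hNo : ∀ μ ∈ cornerGaugeSpaceW (d := d) (n := n) L (j + 1) W (tower L N (j + 1)) (L ^ (j + 1)),
      ∑ y ∈ periodBox (d := d) (tower L N (j + 1)), ∑ κ : Fin d, hsR (Nn y κ) (gaugeDir W μ y κ) = 0)
    (hD : dirIter L (j + 1) W Nn = dirIter L (j + 1) W X₀) :
    ResidualSliceRepT L N (j + 1) W UA u X₀ Nn α₀ := by
  have hXP' : IsPeriodicDir X₀ ((tower L N (j + 1) : ℕ) : ℤ) := by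
    rw [NE3EnergyRateWSupOfSlicePoincare.tower_eq_mul_pow]; exact h.per
  have hNP' : IsPeriodicDir Nn ((tower L N (j + 1) : ℕ) : ℤ) := by
    rw [NE3EnergyRateWSupOfSlicePoincare.tower_eq_mul_pow]; exact hNP
  exact
    { gauge := h.gauge
      cornerTrivial := h.cornerTrivial
      rep := h.rep
      skew := h.skew
      per := h.per
      hα₀ := h.hα₀
      sup := h.sup
      tangent := sub_mem_frameFreeBlockLandauW hL j hWu hx hs hWx h.skew hXP' h.frameFree h.orth hNs hNP' hNF hNo hD }

/-! ## §2 An elementary conversion -/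

/-- **THE ℓ¹-CURL OF THE NORMAL PART AGAINST THAT OF THE LINEAR NORMAL PART**: for unitary `W`, `P`-periodic fields with
`‖N b − Nn b‖ ≤ c·‖Nn b‖` bondwise, `Σ_{perWin}‖curl_W N‖ ≤ Σ_{perWin}‖curl_W Nn‖ + 4d·c·dirL1 Nn (periodBox P)`. [folklore] -/
theorem sum_norm_curl_normalPart_le [Nonempty n] {W : Site d → Fin d → (Matrix n n ℂ)ˣ} (hW : IsUnitaryCfg W) {P : ℕ} (hP : 1 ≤ P)
    {Nn Ng : Site d → Fin d → Matrix n n ℂ} (hNP : IsPeriodicDir Nn P) (hGP : IsPeriodicDir Ng P) {c : ℝ}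
    (hpt : ∀ x μ, ‖Ng x μ - Nn x μ‖ ≤ c * ‖Nn x μ‖) :
    ∑ p ∈ perWin d P, ‖curl W Ng p‖ ≤ ∑ p ∈ perWin d P, ‖curl W Nn p‖ + 4 * d * (c * dirL1 Nn (periodBox (d := d) P)) := by
  have hNg : Ng = Nn + (Ng - Nn) := (add_sub_cancel Nn Ng).symm
  have hsplit : ∀ p, curl W Ng p = curl W Nn p + curl W (Ng - Nn) p := by
    intro p
    conv_lhs => rw [hNg]
    exact curl_add_dir W Nn (Ng - Nn) p
  have hDP : IsPeriodicDir (Ng - Nn) P := fun x κ μ => by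
    show Ng (x + (P : ℤ) • e κ) μ - Nn (x + (P : ℤ) • e κ) μ = Ng x μ - Nn x μ
    rw [hNP x κ μ, hGP x κ μ]
  have h1 : ∑ p ∈ perWin d P, ‖curl W Ng p‖ ≤ ∑ p ∈ perWin d P, ‖curl W Nn p‖ + ∑ p ∈ perWin d P, ‖curl W (Ng - Nn) p‖ := by
    rw [← Finset.sum_add_distrib]
    exact Finset.sum_le_sum fun p _ => by rw [hsplit p]; exact norm_add_le _ _
  have h2 : ∑ p ∈ perWin d P, ‖curl W (Ng - Nn) p‖ ≤ 4 * d * dirL1 (Ng - Nn) (periodBox (d := d) P) := by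
    rw [perWin_eq_plaqsOf]; exact sum_norm_curl_le_dirL1 hW hP hDP
  have hpt' : ∀ x μ, ‖(Ng - Nn) x μ‖ ≤ c * ‖Nn x μ‖ := fun x μ => hpt x μ
  have h3 : dirL1 (Ng - Nn) (periodBox (d := d) P) ≤ c * dirL1 Nn (periodBox (d := d) P) := dirL1_le_of_pointwise hpt' _
  have hd : (0 : ℝ) ≤ 4 * d := by positivity
  have h4 := mul_le_mul_of_nonneg_left h3 hd
  linarith

/-! ## §3 `DecomposedRep` from an R-adapted residual slice representative and the pre-sizes of the linear normal part -/

/-- **`DecomposedRep` FROM A RESIDUAL SLICE REPRESENTATIVE AND A LINEAR NORMAL PART** (level `j+1`, `L, N ≥ 1`; background `W = cavg L U_B`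
unitary, admissible for run A at datum `V`).  See the module docstring for the letters. [folklore] -/
theorem decomposedRep_of_linearNormalPart [Nonempty n] {𝒞 : ℕ → _root_.Set (Site d → Fin d → (Matrix n n ℂ)ˣ)} {L N : ℕ}
    (hL : 1 ≤ L) (hN : 1 ≤ N) (j : ℕ) {V UA UB : Site d → Fin d → (Matrix n n ℂ)ˣ} (hWu : IsUnitaryCfg (cavg L UB))
    (admW : cavg L UB ∈ admissible 𝒞 L (j + 1) V)
    {u : Site d → (Matrix n n ℂ)ˣ} {X₀ Nn : Site d → Fin d → Matrix n n ℂ} {α₀ : ℝ}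
    (h : ResidualSliceRepT L N (j + 1) (cavg L UB) UA u X₀ Nn α₀) (hα₀ : α₀ ≤ 1 / 100)
    {αN : ℝ} (hNP : IsPeriodicDir Nn ((N * L ^ (j + 1) : ℕ) : ℤ))
    (hαN0 : 0 ≤ αN) (hNsup : ∀ y μ, ‖Nn y μ‖ ≤ αN) (hαN : αN ≤ 1 / 2700)
    (hJ1 : (α₀ + 43 * αN) * (L : ℝ) ^ (j + 1) ≤ 1)
    {ν₀ k₁ k₂ a : ℝ} (ha : 0 ≤ a)
    (hnw : energyNormW L (j + 1) (cavg L UB) Nn (periodBox (N * L ^ (j + 1)))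
      ≤ ν₀ * energyNormW L (j + 1) (cavg L UB) (fun y μ => Nn y μ - X₀ y μ) (periodBox (N * L ^ (j + 1))))
    (hcurl : a * ∑ p ∈ perWin d (N * L ^ (j + 1)), ‖curl (cavg L UB) Nn p‖
      ≤ k₁ * energyNormW L (j + 1) (cavg L UB) (fun y μ => Nn y μ - X₀ y μ) (periodBox (N * L ^ (j + 1))) ^ 2)
    (hl1 : a * ((α₀ + αN) * dirL1 Nn (periodBox (N * L ^ (j + 1))))
      ≤ k₂ * energyNormW L (j + 1) (cavg L UB) (fun y μ => Nn y μ - X₀ y μ) (periodBox (N * L ^ (j + 1))) ^ 2)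
    (hsmall : ∀ t ∈ Icc (0:ℝ) 1, ∀ p ∈ perWin d (N * L ^ (j + 1)),
      ‖((fhol (vary (cavg L UB) (pathΓ (fun y μ => Nn y μ - X₀ y μ) (normalPart X₀ fun y μ => Nn y μ - X₀ y μ) t) 1) p
        : (Matrix n n ℂ)ˣ) : Matrix n n ℂ) - 1‖ ≤ a) :
    DecomposedRep 𝒞 L N (j + 1) V UA UB u (fun y μ => Nn y μ - X₀ y μ) (normalPart X₀ fun y μ => Nn y μ - X₀ y μ)
      (α₀ + αN) ((1 + 2048 * (α₀ + αN)) * αN) ((1 + 2048 * Real.sqrt (16 * d + 1)) * ν₀) (k₁ + 8192 * d * k₂) (1806 * k₂) a := by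
  -- written without abbreviations (W = cavg L UB, X = Nn − X₀, N = normalPart X₀ X, F = periodBox (N·L^{j+1}), s = α₀ + αN)
  have hP : 1 ≤ N * L ^ (j + 1) := Nat.mul_pos (by omega) (Nat.pow_pos (by omega))
  obtain ⟨hXs, hXP, -⟩ := mem_frameFreeBlockLandauW_struct h.tangent
  have hα₀0 : 0 ≤ α₀ := h.hα₀
  have hs0 : 0 ≤ α₀ + αN := by positivity
  have h32 : α₀ + αN < 1 / 32 := by linarith
  have hαN32 : αN < 1 / 32 := by linarith
  have hXsup : ∀ y μ, ‖Nn y μ - X₀ y μ‖ ≤ α₀ + αN := fun y μ =>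
    (norm_sub_le _ _).trans (by rw [add_comm]; exact add_le_add (h.sup y μ) (hNsup y μ))
  have hX32 : ∀ y μ, ‖Nn y μ - X₀ y μ‖ ≤ 1 / 32 := fun y μ => (hXsup y μ).trans h32.le
  have hX₀32 : ∀ y μ, ‖X₀ y μ‖ ≤ 1 / 32 := fun y μ => (h.sup y μ).trans (by linarith)
  -- file 1's pointwise facts about `N := normalPart X₀ X`
  have hNgs : IsSkewDir (normalPart X₀ fun y μ => Nn y μ - X₀ y μ) := normalPart_skew h.skew hXs hX₀32 hX32
  have hNgP : IsPeriodicDir (normalPart X₀ fun y μ => Nn y μ - X₀ y μ) ((N * L ^ (j + 1) : ℕ) : ℤ) := fun y κ μ => by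
    simp only [normalPart, h.per y κ μ, hNP y κ μ]
  have hNgsup : ∀ y μ, ‖normalPart X₀ (fun y μ => Nn y μ - X₀ y μ) y μ‖ ≤ (1 + 2048 * (α₀ + αN)) * αN := fun y μ =>
    norm_normalPart_le (hXsup y μ) h32 (hNsup y μ) hαN32
  have hNgsub : ∀ y μ, ‖normalPart X₀ (fun y μ => Nn y μ - X₀ y μ) y μ - Nn y μ‖ ≤ 2048 * (α₀ + αN) * ‖Nn y μ‖ := by
    intro y μ
    have hb := norm_normalPart_sub_le (X₀ := X₀) (Nn := Nn) (y := y) (μ := μ) ((hXsup y μ).trans_lt h32)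
      ((hNsup y μ).trans_lt hαN32)
    have h1 : 0 ≤ ‖Nn y μ‖ := norm_nonneg _
    calc ‖normalPart X₀ (fun y μ => Nn y μ - X₀ y μ) y μ - Nn y μ‖ ≤ 2048 * ‖Nn y μ - X₀ y μ‖ * ‖Nn y μ‖ := hb
      _ ≤ 2048 * (α₀ + αN) * ‖Nn y μ‖ := by nlinarith [hXsup y μ]
  have hrep : ∀ y μ, ((gaugeAct u UA y μ : (Matrix n n ℂ)ˣ) : Matrix n n ℂ)
      = (cavg L UB y μ : Matrix n n ℂ) * (exp (normalPart X₀ (fun y μ => Nn y μ - X₀ y μ) y μ) * exp (-(Nn y μ - X₀ y μ))) := by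
    intro y μ
    have key := exp_normalPart_mul_exp_neg (X₀ := X₀) (X := fun y μ => Nn y μ - X₀ y μ) (y := y) (μ := μ) (hX₀32 y μ) (hX32 y μ)
    rw [h.rep]
    rw [key]
    simp [vary]
  -- numeric helpers
  have h42 : 1 + 2048 * (α₀ + αN) ≤ 42 := by linarith
  have hb : (1 + 2048 * (α₀ + αN)) * αN ≤ 42 * αN := mul_le_mul_of_nonneg_right h42 hαN0
  have hc0 : 0 ≤ 2048 * (α₀ + αN) := by positivity
  have hsL : (α₀ + αN) * (L : ℝ) ^ (j + 1) ≤ 1 := by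
    have h1 : (α₀ + αN) ≤ α₀ + 43 * αN := by linarith
    exact (mul_le_mul_of_nonneg_right h1 (by positivity : (0:ℝ) ≤ (L : ℝ) ^ (j + 1))).trans hJ1
  -- SIZE 1: the weighted norm of `N`
  have hNX := energyNormW_nonneg L (j + 1) (cavg L UB) (fun y μ => Nn y μ - X₀ y μ) (periodBox (d := d) (N * L ^ (j + 1)))
  have hDP : IsPeriodicDir (fun y μ => (normalPart X₀ fun y μ => Nn y μ - X₀ y μ) y μ - Nn y μ) ((N * L ^ (j + 1) : ℕ) : ℤ) :=
    fun y κ μ => by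
      show (normalPart X₀ fun y μ => Nn y μ - X₀ y μ) (y + ((N * L ^ (j + 1) : ℕ) : ℤ) • e κ) μ - Nn (y + ((N * L ^ (j + 1) : ℕ) : ℤ) • e κ) μ
        = (normalPart X₀ fun y μ => Nn y μ - X₀ y μ) y μ - Nn y μ
      rw [hNgP y κ μ, hNP y κ μ]
  have hdiff : energyNormW L (j + 1) (cavg L UB) (fun y μ => (normalPart X₀ fun y μ => Nn y μ - X₀ y μ) y μ - Nn y μ)
        (periodBox (d := d) (N * L ^ (j + 1)))
      ≤ Real.sqrt (16 * d + 1) * (2048 * (α₀ + αN)) * (L : ℝ) ^ (j + 1)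
        * energyNormW L (j + 1) (cavg L UB) Nn (periodBox (d := d) (N * L ^ (j + 1))) :=
    energyNormW_le_of_pointwise hWu hL (j + 1) hP hDP hc0 fun y μ => hNgsub y μ
  have hNg_eq : (normalPart X₀ fun y μ => Nn y μ - X₀ y μ)
      = (fun y μ => (normalPart X₀ fun y μ => Nn y μ - X₀ y μ) y μ - Nn y μ) + Nn := by
    funext y μ; simp only [Pi.add_apply, sub_add_cancel]
  have hnwN : energyNormW L (j + 1) (cavg L UB) (normalPart X₀ fun y μ => Nn y μ - X₀ y μ) (periodBox (d := d) (N * L ^ (j + 1)))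
      ≤ (1 + 2048 * Real.sqrt (16 * d + 1)) * ν₀
        * energyNormW L (j + 1) (cavg L UB) (fun y μ => Nn y μ - X₀ y μ) (periodBox (d := d) (N * L ^ (j + 1))) := by
    have h1 : energyNormW L (j + 1) (cavg L UB) (normalPart X₀ fun y μ => Nn y μ - X₀ y μ) (periodBox (d := d) (N * L ^ (j + 1)))
        ≤ energyNormW L (j + 1) (cavg L UB) (fun y μ => (normalPart X₀ fun y μ => Nn y μ - X₀ y μ) y μ - Nn y μ)
            (periodBox (d := d) (N * L ^ (j + 1)))
          + energyNormW L (j + 1) (cavg L UB) Nn (periodBox (d := d) (N * L ^ (j + 1))) := by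
      conv_lhs => rw [hNg_eq]
      exact energyNormW_add_le L (j + 1) (cavg L UB) _ Nn (periodBox (d := d) (N * L ^ (j + 1)))
    have hNn0 := energyNormW_nonneg L (j + 1) (cavg L UB) Nn (periodBox (d := d) (N * L ^ (j + 1)))
    have h2 : Real.sqrt (16 * d + 1) * (2048 * (α₀ + αN)) * (L : ℝ) ^ (j + 1) ≤ 2048 * Real.sqrt (16 * d + 1) := by
      nlinarith [mul_le_mul_of_nonneg_left hsL (by positivity : (0:ℝ) ≤ 2048 * Real.sqrt (16 * d + 1))]
    have h3 : energyNormW L (j + 1) (cavg L UB) (fun y μ => (normalPart X₀ fun y μ => Nn y μ - X₀ y μ) y μ - Nn y μ)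
          (periodBox (d := d) (N * L ^ (j + 1)))
        ≤ 2048 * Real.sqrt (16 * d + 1) * energyNormW L (j + 1) (cavg L UB) Nn (periodBox (d := d) (N * L ^ (j + 1))) :=
      hdiff.trans (mul_le_mul_of_nonneg_right h2 hNn0)
    have h4 : energyNormW L (j + 1) (cavg L UB) Nn (periodBox (d := d) (N * L ^ (j + 1)))
        ≤ ν₀ * energyNormW L (j + 1) (cavg L UB) (fun y μ => Nn y μ - X₀ y μ) (periodBox (d := d) (N * L ^ (j + 1))) := hnw
    calc energyNormW L (j + 1) (cavg L UB) (normalPart X₀ fun y μ => Nn y μ - X₀ y μ) (periodBox (d := d) (N * L ^ (j + 1)))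
        ≤ (1 + 2048 * Real.sqrt (16 * d + 1)) * energyNormW L (j + 1) (cavg L UB) Nn (periodBox (d := d) (N * L ^ (j + 1))) := by
          linarith
      _ ≤ (1 + 2048 * Real.sqrt (16 * d + 1))
            * (ν₀ * energyNormW L (j + 1) (cavg L UB) (fun y μ => Nn y μ - X₀ y μ) (periodBox (d := d) (N * L ^ (j + 1)))) :=
          mul_le_mul_of_nonneg_left h4 (by positivity)
      _ = _ := by ring
  -- SIZE 2: the ℓ¹-curl of `N`
  have hdl0 : 0 ≤ dirL1 Nn (periodBox (d := d) (N * L ^ (j + 1))) := dirL1_nonneg _ _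
  have hcurlN : a * ∑ p ∈ perWin d (N * L ^ (j + 1)), ‖curl (cavg L UB) (normalPart X₀ fun y μ => Nn y μ - X₀ y μ) p‖
      ≤ (k₁ + 8192 * d * k₂) * energyNormW L (j + 1) (cavg L UB) (fun y μ => Nn y μ - X₀ y μ) (periodBox (d := d) (N * L ^ (j + 1))) ^ 2 := by
    have h1 := sum_norm_curl_normalPart_le hWu hP hNP hNgP (c := 2048 * (α₀ + αN)) fun y μ => hNgsub y μ
    have h2 := mul_le_mul_of_nonneg_left h1 ha
    -- `a·4d·2048·s·dirL1 Nn = 8192·d·(a·(s·dirL1 Nn)) ≤ 8192·d·k₂·‖X‖_w²`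
    have h3 : a * (4 * d * (2048 * (α₀ + αN) * dirL1 Nn (periodBox (d := d) (N * L ^ (j + 1)))))
        = 8192 * d * (a * ((α₀ + αN) * dirL1 Nn (periodBox (d := d) (N * L ^ (j + 1))))) := by ring
    have h4 : 8192 * (d : ℝ) * (a * ((α₀ + αN) * dirL1 Nn (periodBox (d := d) (N * L ^ (j + 1)))))
        ≤ 8192 * d * (k₂ * energyNormW L (j + 1) (cavg L UB) (fun y μ => Nn y μ - X₀ y μ) (periodBox (d := d) (N * L ^ (j + 1))) ^ 2) :=
      mul_le_mul_of_nonneg_left hl1 (by positivity)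
    rw [mul_add, h3] at h2
    linarith
  -- SIZE 3: the ℓ¹ size of `N`
  have hl1N : a * (((α₀ + αN) + (1 + 2048 * (α₀ + αN)) * αN)
        * dirL1 (normalPart X₀ fun y μ => Nn y μ - X₀ y μ) (periodBox (d := d) (N * L ^ (j + 1))))
      ≤ 1806 * k₂ * energyNormW L (j + 1) (cavg L UB) (fun y μ => Nn y μ - X₀ y μ) (periodBox (d := d) (N * L ^ (j + 1))) ^ 2 := by
    have hpt : ∀ y μ, ‖(normalPart X₀ fun y μ => Nn y μ - X₀ y μ) y μ‖ ≤ (1 + 2048 * (α₀ + αN)) * ‖Nn y μ‖ := by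
      intro y μ
      have h1 := hNgsub y μ
      calc ‖(normalPart X₀ fun y μ => Nn y μ - X₀ y μ) y μ‖
          = ‖((normalPart X₀ fun y μ => Nn y μ - X₀ y μ) y μ - Nn y μ) + Nn y μ‖ := by rw [sub_add_cancel]
        _ ≤ ‖(normalPart X₀ fun y μ => Nn y μ - X₀ y μ) y μ - Nn y μ‖ + ‖Nn y μ‖ := norm_add_le _ _
        _ ≤ 2048 * (α₀ + αN) * ‖Nn y μ‖ + ‖Nn y μ‖ := add_le_add h1 le_rfl
        _ = (1 + 2048 * (α₀ + αN)) * ‖Nn y μ‖ := by ring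
    have h2 : dirL1 (normalPart X₀ fun y μ => Nn y μ - X₀ y μ) (periodBox (d := d) (N * L ^ (j + 1)))
        ≤ (1 + 2048 * (α₀ + αN)) * dirL1 Nn (periodBox (d := d) (N * L ^ (j + 1))) := dirL1_le_of_pointwise hpt _
    -- `(s + (1+2048 s)αN) ≤ 43·s` and `(1 + 2048 s) ≤ 42`, so the factor is `≤ 43·42·(s·dirL1 Nn) = 1806·(s·dirL1 Nn)`
    have hf1 : (α₀ + αN) + (1 + 2048 * (α₀ + αN)) * αN ≤ 43 * (α₀ + αN) := by nlinarith
    have hfac0 : 0 ≤ (α₀ + αN) + (1 + 2048 * (α₀ + αN)) * αN := by positivity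
    have h5 : ((α₀ + αN) + (1 + 2048 * (α₀ + αN)) * αN) * dirL1 (normalPart X₀ fun y μ => Nn y μ - X₀ y μ)
          (periodBox (d := d) (N * L ^ (j + 1)))
        ≤ (43 * (α₀ + αN)) * ((1 + 2048 * (α₀ + αN)) * dirL1 Nn (periodBox (d := d) (N * L ^ (j + 1)))) :=
      mul_le_mul hf1 h2 (dirL1_nonneg _ _) (by positivity)
    have h6 : (43 * (α₀ + αN)) * ((1 + 2048 * (α₀ + αN)) * dirL1 Nn (periodBox (d := d) (N * L ^ (j + 1))))
        ≤ (43 * (α₀ + αN)) * (42 * dirL1 Nn (periodBox (d := d) (N * L ^ (j + 1)))) :=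
      mul_le_mul_of_nonneg_left (mul_le_mul_of_nonneg_right h42 hdl0) (by positivity)
    have h7 : a * (((α₀ + αN) + (1 + 2048 * (α₀ + αN)) * αN)
          * dirL1 (normalPart X₀ fun y μ => Nn y μ - X₀ y μ) (periodBox (d := d) (N * L ^ (j + 1))))
        ≤ a * ((43 * (α₀ + αN)) * (42 * dirL1 Nn (periodBox (d := d) (N * L ^ (j + 1))))) :=
      mul_le_mul_of_nonneg_left (h5.trans h6) ha
    have h8 : a * ((43 * (α₀ + αN)) * (42 * dirL1 Nn (periodBox (d := d) (N * L ^ (j + 1)))))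
        = 1806 * (a * ((α₀ + αN) * dirL1 Nn (periodBox (d := d) (N * L ^ (j + 1))))) := by ring
    have h9 := mul_le_mul_of_nonneg_left hl1 (by norm_num : (0:ℝ) ≤ 1806)
    linarith
  -- assemble
  exact
    { gauge := h.gauge
      rep := hrep
      skewX := hXs
      perX := hXP
      skewN := hNgs
      perN := hNgP
      tangent := h.tangent
      supX := hXsup
      supN := hNgsup
      hα0 := hs0
      hαN0 := by positivity
      hα := by linarith
      hαN := by linarith
      hαk := by
        have h1 : (α₀ + αN) + (1 + 2048 * (α₀ + αN)) * αN ≤ α₀ + 43 * αN := by linarith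
        exact (mul_le_mul_of_nonneg_right h1 (by positivity : (0:ℝ) ≤ (L : ℝ) ^ (j + 1))).trans hJ1
      admW := admW
      ha := ha
      small := hsmall
      nwN := hnwN
      curlN := hcurlN
      l1N := hl1N }

end

end Summit.QuantumFields.BalabanUV.T4Continuum.NE3DecomposedRepOfLinearNormalPart
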